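import Summits.Schanuel.Schanuel.Theorems.RootDecomp1EModuleGrids
import Summits.Schanuel.Schanuel.Theses.RootDecomp1

-- `Summit.Schanuel.Schanuel.…` is the mandated layout of this single-problem summit (CONVENTIONS §1).
set_option linter.dupNamespace false

/-!
# RootDecomp1E — lens 2, gen 8 «ModuleGrids»: the CONVERGENCE EDGE `SchanuelTwo ≽ DefectOneSchanuel(3)`

Isolated from `RootDecomp1EModuleGrids` (critic H-c, 2026-08-30T10:27:17Z) because it imports the trunk route file
`Theses.RootDecomp1` for `SchanuelTwo` (stmt-Schanuel-0069): the shared crux `SchanuelTwo` implies the `n = 3` layer of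
`DefectOneSchanuel` — hence the first open layer of `PlainDefectOne` (stmt-Schanuel-31410) — by the pair criterion
`two_le_trdeg_three_iff_pairs` of part 1. Sorry-free; axioms standard.
-/

noncomputable section

namespace Summit.Schanuel.Schanuel.Theorems.RootDecomp1EModuleGrids

open Complex IntermediateField
open Summit.Schanuel.Schanuel.Theorems.RootDecomp1EAnchor (isAlgebraic_of_mem_adjoin
  trdeg_adjoin_le_of_isAlgebraic mem_adjoin_of_mem_span exp_isAlgebraic_of_mem_span trdeg_le_of_mem_span)
open Literature.Barriers.Schanuel (gridField₂ smallTrdeg_thm_2_9_pos smallTrdeg_thm_2_9_two_two trdeg_mono)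
open Literature.NumberTheory.Transcendental (transcendental_exp_holds)
open Summit.Schanuel.Schanuel.Theorems.RootDecomp1EEStableRung (defectOne_of_le_two
  one_le_trdeg_adjoin_of_transcendental)

/-- **CONVERGENCE EDGE `SchanuelTwo ≽ DefectOneSchanuel(3)`**: the shared crux `SchanuelTwo`
(stmt-Schanuel-0069, `RootDecomp1.SchanuelTwo` = `RoyCriterion.SchanuelTwo`) implies the `n = 3` layer of
`DefectOneSchanuel` — hence the first open layer of `PlainDefectOne` (stmt-31410) and the decided layer of
`EStableDefectOne` (stmt-31409) — by the pair criterion (one rich pair suffices). -/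
theorem defectOne_three_of_schanuelTwo (hS2 : Summit.Schanuel.Schanuel.Theses.RootDecomp1.SchanuelTwo)
    (z : Fin 3 → ℂ) (hz : LinearIndependent ℚ z) :
    ((3 : ℕ) : Cardinal) ≤ Algebra.trdeg ℚ ↥(adjoin ℚ (Set.range z ∪ Set.range (cexp ∘ z))) + 1 := by
  have h2 : (2 : Cardinal) ≤ Algebra.trdeg ℚ ↥(adjoin ℚ (Set.range z ∪ Set.range (cexp ∘ z))) :=
    (two_le_trdeg_three_iff_pairs z hz).mpr (Or.inl (hS2 _ (pair01_linearIndependent z hz)))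
  have h := add_le_add h2 (le_rfl : (1 : Cardinal) ≤ 1)
  have h21 : (2 : Cardinal) + 1 = ((3 : ℕ) : Cardinal) := by norm_num
  rwa [h21] at h

/-- Hence `SchanuelTwo ⇒` the `n = 3` layer of `PlainDefectOne` (in the simplified form of
`plainDefectOne_three_iff`). -/
theorem plainDefectOne_three_of_schanuelTwo
    (hS2 : Summit.Schanuel.Schanuel.Theses.RootDecomp1.SchanuelTwo) :
    ∀ z : Fin 3 → ℂ, LinearIndependent ℚ z →
      (∀ β : ℂ, IsAlgebraic ℚ β → (∀ i, β * z i ∈ Submodule.span ℚ (Set.range z)) →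
        β ∈ Set.range (algebraMap ℚ ℂ)) →
      ((3 : ℕ) : Cardinal) ≤ Algebra.trdeg ℚ ↥(adjoin ℚ (Set.range z ∪ Set.range (cexp ∘ z))) + 1 :=
  fun z hz _ => defectOne_three_of_schanuelTwo hS2 z hz

end Summit.Schanuel.Schanuel.Theorems.RootDecomp1EModuleGrids
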